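import Literature.NumberTheory.NumberFields.InfinitePlaceTransportRigidity
import Literature.IUT.LogVolume.ArithmeticDivisorsFrdBridge
import Literature.NumberTheory.GaloisRepresentations.FrobeniusDensityTheorem
import Mathlib.NumberTheory.NumberField.ClassNumber
import HarnessLib

/-!
# A transport of principal arithmetic divisors along place permutations is Galois at infinity

Classical algebraic number theory (PROOF-ONLY; no definitions, no named facts).  Let `L/ℚ` be a finite Galois
extension, and let `Γ : Φ(L)^gp →+ Φ(L)^gp` be an additive self-map of the group of arithmetic divisors of `L`
(abc-iut-L1-t3's `ArithDivisor L = (FinitePlace L →₀ ℤ) × (InfinitePlace L → ℝ)`) which RELABELS places: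
`(Γ d)(ρ_f w) = d(w)` at finite places and `(Γ d)(ρ_∞ v) = d(v)` at infinite places for permutations `ρ_f`, `ρ_∞`,
and which carries PRINCIPAL divisors `div(x)`, `x ∈ L^×`, to principal divisors.

**Theorem** (`exists_algEquiv_forall_eq_smul`): `ρ_∞` is induced by a field automorphism — there is
`s ∈ Gal(L/ℚ)` with `ρ_∞ v = s • v` for every infinite place `v`.

Proof: take a maximal ideal `𝔓` of `𝓞 L` with trivial decomposition group (a prime above a completely split
rational prime; the tree's density theorem for split primes, `hasStrongDirichletDensity_splitPrimes`), `h ≥ 1`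
with `𝔓ʰ = (X)` principal (finiteness of the class group), and the partner `y` of `X` (`Γ(div X) = div y`);
then `y ∈ 𝓞 L` generates `𝔓'ʰ` for the maximal ideal `𝔓'` at `ρ_f(𝔓)` and `(ρ_∞ v)(y) = v(X)` for all `v`, so the
square-and-compare-ideals lemma (`InfinitePlaceTransportRigidity`, here re-run for a pair `(X) = 𝔓ʰ`,
`(Y) = 𝔓'ʰ`: `exists_smul_eq_and_eq_smul`) gives `s_v ∈ Gal(L/ℚ)` with `s_v • 𝔓 = 𝔓'` and `ρ_∞ v = s_v • v`;
trivial decomposition group makes `s_v = s` independent of `v`.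

Use (cell abc-iut, layer L1, GAP-LEDGER G-L1t3-1 #2 — [FrdI] Thm. 6.4 (iv) compatibility clause in the
non-solitary case): `Γ` = the groupified divisor-monoid isomorphism `Ψ^Φ` of an equivalence of arithmetic
Frobenioids, read on `L₁` through the field isomorphism `L₁ ≅ L₂`.  Nothing here is specific to, or takes a
side on, the disputed corpus.
-/

noncomputable section

open NumberField NumberField.InfinitePlace NumberField.ComplexEmbedding IsDedekindDomain
open Literature.AlgebraicGeometry.Frobenioids

open scoped Pointwise

namespace Literature.NumberTheory.NumberFields

variable {L : Type} [Field L] [NumberField L]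

/-! ### Square-and-compare-ideals for a pair of generators `(X) = 𝔓ⁿ`, `(Y) = 𝔓'ⁿ` -/

/-- **Square-and-compare-ideals, two-prime form**: if `w (Y) = v (X)` for infinite places `v, w` of the Galois
number field `L`, where `(X) = 𝔓ⁿ`, `(Y) = 𝔓'ⁿ` (`n ≠ 0`) for maximal ideals `𝔓, 𝔓'`, then for the twist `t`
with `w = t⁻¹ • v` and the conjugation `c` of `v`, `t • 𝔓'` is `𝔓` or `c • 𝔓`.
[cite: MochizukiFrdI2008, Thm. 6.4 (iv) p.115] -/
theorem smul_eq_or_of_apply_eq_of_span_eq [IsGalois ℚ L] {𝔓 𝔓' : Ideal (𝓞 L)} (h𝔓 : 𝔓.IsMaximal)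
    (h𝔓' : 𝔓'.IsMaximal) {X Y : 𝓞 L} {n : ℕ} (hn : n ≠ 0) (hX : Ideal.span {X} = 𝔓 ^ n)
    (hY : Ideal.span {Y} = 𝔓' ^ n) (v w : InfinitePlace L) (h : w (Y : L) = v (X : L)) :
    ∃ t c : L ≃ₐ[ℚ] L, w = t⁻¹ • v ∧ c • v = v ∧ (t • 𝔓' = 𝔓 ∨ t • 𝔓' = c • 𝔓) := by
  classical
  set φ := v.embedding with hφ
  obtain ⟨t, ht⟩ := exists_ringHom_eq_comp φ w.embedding
  obtain ⟨c, hc⟩ := exists_conjugate_eq_comp φ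
  obtain ⟨c', hc'⟩ := exists_conjugate_eq_comp w.embedding
  have hv : InfinitePlace.mk φ = v := mk_embedding v
  have hw : w = t⁻¹ • v := by
    rw [← mk_embedding w, ht, ← hv, smul_mk]
    rfl
  refine ⟨t, c, hw, by rw [← hv]; exact smul_mk_eq_of_conjugate_eq_comp hc, ?_⟩
  -- the squared identity in `L`: `t (Y · c' Y) = X · c X`
  have hsq : (((w (Y : L)) ^ 2 : ℝ) : ℂ) = (((v (X : L)) ^ 2 : ℝ) : ℂ) := by rw [h]
  rw [← mk_embedding w, ofReal_apply_sq_eq hc', ← hv, ofReal_apply_sq_eq hc, ht, RingHom.comp_apply] at hsq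
  have hL : t ((Y : L) * c' (Y : L)) = (X : L) * c (X : L) := φ.injective (by simpa using hsq)
  have hO : (t • (Y * (c' • Y)) : 𝓞 L) = X * (c • X) := by
    apply RingOfIntegers.ext
    have e1 : ((Y * c' • Y : 𝓞 L) : L) = (Y : L) * c' (Y : L) := by
      rw [RingOfIntegers.coe_eq_algebraMap, map_mul]; rfl
    have e2 : ((X * c • X : 𝓞 L) : L) = (X : L) * c (X : L) := by
      rw [RingOfIntegers.coe_eq_algebraMap, map_mul]; rfl
    rw [coe_smul_ringOfIntegers, e1, e2]
    exact hL
  -- ideals: `(t • 𝔓')ⁿ ((t c') • 𝔓')ⁿ = 𝔓ⁿ (c • 𝔓)ⁿ`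
  have hideal : (t • 𝔓') ^ n * ((t * c') • 𝔓') ^ n = 𝔓 ^ n * (c • 𝔓) ^ n := by
    have h1 := congrArg (fun Z : 𝓞 L => Ideal.span {Z}) hO
    rw [← smul_span_singleton, ← Ideal.span_singleton_mul_span_singleton, ← smul_span_singleton, hY,
      ← Ideal.span_singleton_mul_span_singleton, ← smul_span_singleton, hX, smul_mul', ← mul_smul,
      smul_pow', smul_pow', smul_pow'] at h1
    exact h1
  have hprime : (t • 𝔓').IsMaximal := by
    rw [Ideal.pointwise_smul_def]
    exact Ideal.map_isMaximal_of_equiv (MulSemiringAction.toRingEquiv _ (𝓞 L) t) (p := 𝔓')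
  have hdvd : t • 𝔓' ∣ 𝔓 ^ n * (c • 𝔓) ^ n := by
    rw [← hideal]
    exact Dvd.dvd.mul_right (dvd_pow_self _ hn) _
  have hP : Prime (t • 𝔓') :=
    Ideal.prime_of_isPrime (Ring.ne_bot_of_isMaximal_of_not_isField hprime (RingOfIntegers.not_isField L))
      hprime.isPrime
  rcases hP.dvd_or_dvd hdvd with h1 | h1
  · exact Or.inl (eq_of_dvd_of_isMaximal hprime h𝔓 (hP.dvd_of_dvd_pow h1))
  · refine Or.inr (eq_of_dvd_of_isMaximal hprime ?_ (hP.dvd_of_dvd_pow h1))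
    rw [Ideal.pointwise_smul_def]
    exact Ideal.map_isMaximal_of_equiv (MulSemiringAction.toRingEquiv _ (𝓞 L) c) (p := 𝔓)

/-- **Square-and-compare-ideals, conclusion**: under the same hypotheses some `s ∈ Gal(L/ℚ)` carries `𝔓` to
`𝔓'` AND `v` to `w`. [cite: MochizukiFrdI2008, Thm. 6.4 (iv) p.115] -/
theorem exists_smul_eq_and_eq_smul [IsGalois ℚ L] {𝔓 𝔓' : Ideal (𝓞 L)} (h𝔓 : 𝔓.IsMaximal)
    (h𝔓' : 𝔓'.IsMaximal) {X Y : 𝓞 L} {n : ℕ} (hn : n ≠ 0) (hX : Ideal.span {X} = 𝔓 ^ n)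
    (hY : Ideal.span {Y} = 𝔓' ^ n) (v w : InfinitePlace L) (h : w (Y : L) = v (X : L)) :
    ∃ s : L ≃ₐ[ℚ] L, s • 𝔓 = 𝔓' ∧ w = s • v := by
  obtain ⟨t, c, hw, hcv, hor⟩ := smul_eq_or_of_apply_eq_of_span_eq h𝔓 h𝔓' hn hX hY v w h
  rcases hor with h1 | h1
  · refine ⟨t⁻¹, ?_, hw⟩
    rw [← h1, inv_smul_smul]
  · refine ⟨t⁻¹ * c, ?_, ?_⟩
    · rw [mul_smul, ← h1, inv_smul_smul]
    · rw [mul_smul, hcv, hw]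

/-! ### A prime with trivial decomposition group -/

/-- **A Galois number field has a prime with trivial decomposition group** (a prime above a rational prime
that splits completely: the completely split primes have density `1/[L:ℚ] > 0`, and `#D = e f = 1`).
[cite: MochizukiFrdI2008, Thm. 6.4 (iv) p.115] -/
theorem exists_forall_smul_eq_imp_eq_one [IsGalois ℚ L] :
    ∃ 𝔓 : HeightOneSpectrum (𝓞 L), ∀ g : L ≃ₐ[ℚ] L, g • 𝔓.asIdeal = 𝔓.asIdeal → g = 1 := by
  classical
  -- a completely split rational prime `q` and a prime `𝔓` of `L` above it
  have hdens := GaloisRepresentations.hasStrongDirichletDensity_splitPrimes ℚ L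
  have hpos : (0 : ℝ) < 1 / (Module.finrank ℚ L : ℕ) := by
    have : (0 : ℝ) < (Module.finrank ℚ L : ℕ) := by exact_mod_cast Module.finrank_pos
    positivity
  obtain ⟨q, hq⟩ := (hdens.infinite hpos).nonempty
  haveI := q.isMaximal
  obtain ⟨Q, hQmax, hQover⟩ := Ideal.exists_maximal_ideal_liesOver_of_isIntegral (S := 𝓞 L) q.asIdeal
  have hQbot : Q ≠ ⊥ := Ideal.ne_bot_of_liesOver_of_ne_bot q.ne_bot Q
  refine ⟨⟨Q, hQmax.isPrime, hQbot⟩, fun g hg => ?_⟩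
  -- `#Stab(Q) = e · f = 1`
  haveI : IsGaloisGroup (L ≃ₐ[ℚ] L) (𝓞 ℚ) (𝓞 L) := IsGaloisGroup.of_isFractionRing _ _ _ ℚ L
  haveI := hQmax.isPrime
  haveI := hQover
  obtain ⟨hunr, hsplit⟩ := GaloisRepresentations.mem_splitPrimes_iff.mp hq
  have hQ : Q ∈ q.asIdeal.primesOver (𝓞 L) := ⟨hQmax.isPrime, hQover⟩
  have hcard : Nat.card (MulAction.stabilizer (L ≃ₐ[ℚ] L) Q) = 1 := by
    rw [Ideal.card_stabilizer_eq (G := L ≃ₐ[ℚ] L) q.asIdeal Q,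
      Ideal.ramificationIdxIn_eq_ramificationIdx q.asIdeal Q (L ≃ₐ[ℚ] L),
      Ideal.inertiaDegIn_eq_inertiaDeg q.asIdeal Q (L ≃ₐ[ℚ] L),
      Ideal.ramificationIdx_eq_one_iff.mpr (hunr Q hQ.1 hQ.2), hsplit Q hQ]
  have hbot : MulAction.stabilizer (L ≃ₐ[ℚ] L) Q = ⊥ := Subgroup.eq_bot_of_card_eq _ hcard
  have hmem : g ∈ MulAction.stabilizer (L ≃ₐ[ℚ] L) Q := hg
  rw [hbot] at hmem
  exact Subgroup.mem_bot.mp hmem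

/-! ### Principal powers of primes; orders and multiplicities -/

/-- Some power `𝔓ʰ` (`h ≥ 1`) of a maximal ideal is principal, generated by some `X ≠ 0` (finiteness of the class
group). [cite: MochizukiFrdI2008, Thm. 6.4 (i) p.115] -/
theorem exists_span_singleton_eq_pow (𝔓 : HeightOneSpectrum (𝓞 L)) :
    ∃ (h : ℕ) (X : 𝓞 L), h ≠ 0 ∧ X ≠ 0 ∧ Ideal.span {X} = 𝔓.asIdeal ^ h := by
  classical
  set h := Fintype.card (ClassGroup (𝓞 L)) with hh
  have hpow : 𝔓.asIdeal ^ h ≠ ⊥ := pow_ne_zero _ 𝔓.ne_bot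
  have hI : 𝔓.asIdeal ^ h ∈ nonZeroDivisors (Ideal (𝓞 L)) := mem_nonZeroDivisors_of_ne_zero hpow
  have hv : 𝔓.asIdeal ∈ nonZeroDivisors (Ideal (𝓞 L)) := mem_nonZeroDivisors_of_ne_zero 𝔓.ne_bot
  have h1 : ClassGroup.mk0 ⟨𝔓.asIdeal ^ h, hI⟩ = 1 := by
    have : (⟨𝔓.asIdeal ^ h, hI⟩ : nonZeroDivisors (Ideal (𝓞 L))) = ⟨𝔓.asIdeal, hv⟩ ^ h := by
      ext; simp
    rw [this, map_pow]
    exact pow_card_eq_one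
  haveI : (𝔓.asIdeal ^ h).IsPrincipal := (ClassGroup.mk0_eq_one_iff hI).mp h1
  obtain ⟨X, hX⟩ := Submodule.IsPrincipal.principal (𝔓.asIdeal ^ h)
  have hX0 : X ≠ 0 := by
    rintro rfl
    apply hpow
    rw [hX]
    simp
  exact ⟨h, X, Fintype.card_ne_zero, hX0, hX.symm⟩

/-- `ord_w(X) = ord_w((X))`: [FrdI]'s order at the finite place of `v` of a nonzero algebraic integer `X` is the
multiplicity of `v` in `(X)`. [cite: MochizukiFrdI2008, Ex. 6.3 p.113] -/
theorem ordFin_mk_mk0_eq_multiplicity (v : HeightOneSpectrum (𝓞 L)) {X : 𝓞 L} (hX : X ≠ 0)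
    (hXL : (X : L) ≠ 0) :
    ordFin L (FinitePlace.mk v) (Units.mk0 (X : L) hXL) = multiplicity v.asIdeal (Ideal.span {X}) := by
  rw [Literature.IUT.LogVolume.ordFin_mk_eq_ord, Units.val_mk0, Literature.IUT.LogVolume.ord,
    show (X : L) = algebraMap (𝓞 L) L X from rfl, HeightOneSpectrum.valuation_of_algebraMap,
    HeightOneSpectrum.intValuation_eq_exp_neg_multiplicity v hX, WithZero.log_exp, neg_neg]

/-- An element all of whose orders are nonnegative is an algebraic integer. [cite: MochizukiFrdI2008, Ex. 6.3 p.113] -/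
theorem exists_ringOfIntegers_coe_eq (y : Lˣ) (h : ∀ w : FinitePlace L, 0 ≤ ordFin L w y) :
    ∃ Y : 𝓞 L, (Y : L) = y := by
  have hy : (y : L) ∈ (algebraMap (𝓞 L) L).range := by
    apply HeightOneSpectrum.mem_integers_of_valuation_le_one
    intro v
    have hv := h (FinitePlace.mk v)
    rw [Literature.IUT.LogVolume.ordFin_mk_eq_ord, Literature.IUT.LogVolume.ord, neg_nonneg] at hv
    have := WithZero.le_exp_of_log_le hv
    rwa [WithZero.exp_zero] at this
  obtain ⟨Y, hY⟩ := hy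
  exact ⟨Y, hY⟩

/-- Nonzero ideals of `𝓞 L` with the same multiplicity at every prime are equal (unique factorisation).
[cite: MochizukiFrdI2008, Ex. 6.3 p.113] -/
theorem ideal_eq_of_forall_multiplicity_eq {I J : Ideal (𝓞 L)} (hI : I ≠ ⊥) (hJ : J ≠ ⊥)
    (h : ∀ v : HeightOneSpectrum (𝓞 L), multiplicity v.asIdeal I = multiplicity v.asIdeal J) : I = J := by
  rw [← Ideal.finprod_heightOneSpectrum_pow_multiplicity hI, ← Ideal.finprod_heightOneSpectrum_pow_multiplicity hJ]
  exact finprod_congr fun v => by rw [h v]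

/-- A prime `v ≠ 𝔓` has multiplicity `0` in a prime power `𝔓ʰ`. [cite: MochizukiFrdI2008, Ex. 6.3 p.113] -/
theorem multiplicity_asIdeal_pow_of_ne {v 𝔓 : HeightOneSpectrum (𝓞 L)} (hv : v ≠ 𝔓) (h : ℕ) :
    multiplicity v.asIdeal (𝔓.asIdeal ^ h) = 0 := by
  rw [multiplicity_eq_zero]
  intro hdvd
  apply hv
  have hle : 𝔓.asIdeal ≤ v.asIdeal := Ideal.le_of_dvd (v.prime.dvd_of_dvd_pow hdvd)
  exact HeightOneSpectrum.ext (𝔓.isMaximal.eq_of_le v.isPrime.ne_top hle).symm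

/-! ### The theorem -/

/-- **A transport of principal arithmetic divisors along place permutations is Galois at infinity**: for
`L/ℚ` Galois and an additive self-map `Γ` of `Φ(L)^gp` relabelling finite places by `ρ_f` and infinite places by
`ρ_∞` and carrying principal divisors to principal divisors, `ρ_∞ = (s • ·)` for some `s ∈ Gal(L/ℚ)`.
[cite: MochizukiFrdI2008, Thm. 6.4 (iv) p.115] -/
theorem exists_algEquiv_forall_eq_smul [IsGalois ℚ L] (Γ : ArithDivisor L →+ ArithDivisor L)
    (ρf : FinitePlace L ≃ FinitePlace L) (ρi : InfinitePlace L ≃ InfinitePlace L)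
    (hfin : ∀ (d : ArithDivisor L) (w : FinitePlace L), (Γ d).1 (ρf w) = d.1 w)
    (harch : ∀ (d : ArithDivisor L) (v : InfinitePlace L), (Γ d).2 (ρi v) = d.2 v)
    (hprinc : ∀ x : Lˣ, ∃ y : Lˣ, Γ (principalArithDivisor L x) = principalArithDivisor L y) :
    ∃ s : L ≃ₐ[ℚ] L, ∀ v : InfinitePlace L, ρi v = s • v := by
  classical
  obtain ⟨𝔓, htriv⟩ := exists_forall_smul_eq_imp_eq_one (L := L)
  obtain ⟨h, X, hh, hX0, hX⟩ := exists_span_singleton_eq_pow 𝔓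
  have hXL : (X : L) ≠ 0 := fun h0 => hX0 (by exact_mod_cast h0)
  set x : Lˣ := Units.mk0 (X : L) hXL with hx
  obtain ⟨y, hy⟩ := hprinc x
  -- orders of the partner `y`
  have hordy : ∀ w : FinitePlace L, ordFin L w y = ordFin L (ρf.symm w) x := fun w => by
    have := hfin (principalArithDivisor L x) (ρf.symm w)
    rw [hy, Equiv.apply_symm_apply, principalArithDivisor_fst, principalArithDivisor_fst] at this
    exact this
  have hordx : ∀ w : FinitePlace L,
      ordFin L w x = multiplicity w.maximalIdeal.asIdeal (Ideal.span {X}) := fun w => by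
    conv_lhs => rw [← FinitePlace.mk_maximalIdeal w]
    exact ordFin_mk_mk0_eq_multiplicity w.maximalIdeal hX0 hXL
  -- `y` is an algebraic integer `Y ≠ 0`
  obtain ⟨Y, hY⟩ := exists_ringOfIntegers_coe_eq y fun w => by
    rw [hordy, hordx]; exact Int.natCast_nonneg _
  have hYL : (Y : L) ≠ 0 := by rw [hY]; exact y.ne_zero
  have hY0 : Y ≠ 0 := fun h0 => hYL (by rw [h0]; rfl)
  have hyY : y = Units.mk0 (Y : L) hYL := Units.ext hY.symm
  -- `(Y) = 𝔓'ʰ` for the prime `𝔓'` at `ρ_f(𝔓)`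
  set 𝔓' : HeightOneSpectrum (𝓞 L) := (ρf (FinitePlace.mk 𝔓)).maximalIdeal with h𝔓'
  have hspanY : Ideal.span {Y} = 𝔓'.asIdeal ^ h := by
    refine ideal_eq_of_forall_multiplicity_eq (by simpa [Ideal.span_singleton_eq_bot] using hY0)
      (pow_ne_zero _ 𝔓'.ne_bot) fun v => ?_
    have h1 : (multiplicity v.asIdeal (Ideal.span {Y}) : ℤ) =
        multiplicity (ρf.symm (FinitePlace.mk v)).maximalIdeal.asIdeal (Ideal.span {X}) := by
      rw [← ordFin_mk_mk0_eq_multiplicity v hY0 hYL, ← hyY, hordy, hordx]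
    have h2 : (ρf.symm (FinitePlace.mk v)).maximalIdeal = 𝔓 ↔ v = 𝔓' := by
      constructor
      · intro h3
        have h4 : ρf.symm (FinitePlace.mk v) = FinitePlace.mk 𝔓 := by
          rw [← FinitePlace.mk_maximalIdeal (ρf.symm (FinitePlace.mk v)), h3]
        have h5 : FinitePlace.mk v = ρf (FinitePlace.mk 𝔓) := by rw [← h4, Equiv.apply_symm_apply]
        rw [h𝔓', ← h5, FinitePlace.maximalIdeal_mk]
      · intro h3
        rw [h3, h𝔓', FinitePlace.mk_maximalIdeal, Equiv.symm_apply_apply, FinitePlace.maximalIdeal_mk]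
    rw [hX] at h1
    by_cases hv : v = 𝔓'
    · have h3 : (ρf.symm (FinitePlace.mk v)).maximalIdeal = 𝔓 := h2.mpr hv
      rw [h3, multiplicity_pow_self_of_prime 𝔓.prime] at h1
      subst hv
      rw [multiplicity_pow_self_of_prime 𝔓'.prime]
      exact_mod_cast h1
    · have hne : (ρf.symm (FinitePlace.mk v)).maximalIdeal ≠ 𝔓 := fun h' => hv (h2.mp h')
      rw [multiplicity_asIdeal_pow_of_ne hne] at h1
      rw [multiplicity_asIdeal_pow_of_ne hv]
      exact_mod_cast h1
  -- archimedean absolute values of the partner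
  have harchy : ∀ v : InfinitePlace L, (ρi v) (Y : L) = v (X : L) := fun v => by
    have := harch (principalArithDivisor L x) v
    rw [hy, principalArithDivisor_snd, principalArithDivisor_snd, neg_inj, hyY, Units.val_mk0, hx,
      Units.val_mk0] at this
    exact Real.log_injOn_pos ((ρi v).pos_iff.mpr hYL) (v.pos_iff.mpr hXL) this
  -- rigidity at each infinite place, and uniqueness of the transporting element
  have key : ∀ v : InfinitePlace L, ∃ s : L ≃ₐ[ℚ] L, s • 𝔓.asIdeal = 𝔓'.asIdeal ∧ ρi v = s • v := fun v =>
    exists_smul_eq_and_eq_smul 𝔓.isMaximal 𝔓'.isMaximal hh hX hspanY v (ρi v) (harchy v)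
  obtain ⟨v₀⟩ := (inferInstance : Nonempty (InfinitePlace L))
  obtain ⟨s, hs, -⟩ := key v₀
  refine ⟨s, fun v => ?_⟩
  obtain ⟨s', hs', hv⟩ := key v
  have hss' : s⁻¹ * s' = 1 := htriv _ (by rw [mul_smul, hs', ← hs, inv_smul_smul])
  rw [hv, ← inv_mul_eq_one.mp hss']

end Literature.NumberTheory.NumberFields

end
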